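import Mathlib
import HarnessLib
import Summits.HubbardSuperconductivity.HubbardSuperconductivity.Theorems.KLProgrammeKLRegimeBetaSplitV9S
import Summits.HubbardSuperconductivity.HubbardSuperconductivity.Theorems.KLProgrammeKLRegimeSplitBundleV14

/-!
# Route `KLProgramme` — crux K3 gen 5, CHILD 1 at the V14 bundle: `betaSplitP_klPredsV14 (W) : BetaSplitP klPredsV14 W`
# (the gen-5 child-1 statement `BetaSplitP klPredsV14 klWindowC` closes BY NAME with this theorem at `W := klWindowC`)

Cell gate-hubbard-kl, seat hubbard-kl-k3c1-p1 (g4; interim child-1 pen, plan g12 02:13:06Z).  `klPredsV14` (`…SplitBundleV14`, p2 g7 p488735) has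
`split := BetaSplitAtS2` and `engine := EngineBoundsAtV9S` (the (E2-v9) slot of `…SplitEngineV9`, p1 g8 — E2-DRIVE repair), so child 1 is
`betaSplitP_of_slotsV9S` (p488227) with the two identity slot maps — exactly as `betaSplitP_klPredsV12` (p475114) was for gen 4.  The by-name
route closer `theorem … : …Theses.KLProgramme.KLRegimeBetaSplitV14 := betaSplitP_klPredsV14 klWindowC` is filed against the gen-5 item once the
resplit renders it.  Everything is proved; nothing about the model is asserted.  0 kit.
-/

noncomputable section

namespace Summit.HubbardSuperconductivity.HubbardSuperconductivity.Theorems.KLRegimeSplit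

set_option linter.dupNamespace false -- summit = problem name (single-conjunct summit), D-0017

/-- **Child 1 at the V14 bundle, every covariance window** (in particular `klWindowC`: the gen-5 route item `KLRegimeBetaSplitV14`). -/
theorem betaSplitP_klPredsV14 (W : Set ℝ) : BetaSplitP klPredsV14 W :=
  betaSplitP_of_slotsV9S (Pr := klPredsV14) (fun _ _ _ _ _ _ _ _ _ _ _ _ h => h) (fun _ _ _ _ _ _ _ _ _ _ _ _ h => h)

end Summit.HubbardSuperconductivity.HubbardSuperconductivity.Theorems.KLRegimeSplit

end
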